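import Literature.GroupTheory.CombinatorialGroupTheory.RandomSclFreeGroupPairingBound
import HarnessLib

/-!
# Random rigidity of scl (Calegari–Walker 2013): proofs, part 36 — counting the fan tokens

D. Calegari, A. Walker, *Random rigidity in the free group*, Geom. Topol. 17 (2013)
[CalegariWalker2013], §4.4. For the fan resolution (parts 32–35) of the fatgraph of a
fixed-point-free permutation `τ` of `Fin N`: the valid pairs `(x, s)` (`x` big, `s ≤ ff x`) number
`3·#big − 6·#(big orbits)`, whence **`#tokens + 6·orb(τ) ≤ 3N`** (a bivalent orbit has two
points); the valid pairs at bad corners number at most `3·#Bad` when apexes are chosen outside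
`Bad` whenever possible; and sums over real tokens are sums over big corners.

* **`card_univ_filter_val_lt`** — `#{s : Fin N | s < m} = m` for `m ≤ N`.
* **`fan_orbit_size_le`** — `rr x ≤ N`.
* **`fan_card_validPairs_add`** — `#valid pairs + 6·#apexes = 3·#big`.
* **`fan_card_validPairs_add_six_mul_orbitCount_le`** — `#valid pairs + 6·orb(τ) ≤ 3N`.
* **`fan_card_validPairs_bad_le`** — valid pairs at bad corners `≤ 3·#Bad`.
* **`fan_sum_real_eq`** — transport of sums over real tokens to big corners.
-/

noncomputable section

namespace Literature.GroupTheory.CombinatorialGroupTheory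

section FanCounts

open Equiv Finset

open scoped Classical

/-- `#{s : Fin N | s < m} = m` for `m ≤ N`. [folklore] -/
theorem card_univ_filter_val_lt {N m : ℕ} (h : m ≤ N) :
    ((Finset.univ : Finset (Fin N)).filter fun s : Fin N => (s : ℕ) < m).card = m := by
  apply Finset.card_eq_of_bijective (fun i hi => (⟨i, by omega⟩ : Fin N))
  · intro s hs
    rw [Finset.mem_filter] at hs
    exact ⟨s, hs.2, rfl⟩
  · intro i hi
    rw [Finset.mem_filter]
    exact ⟨Finset.mem_univ _, hi⟩
  · intro i j hi hj hij
    exact congrArg Fin.val hij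

variable {N : ℕ} (τ : Equiv.Perm (Fin N)) (apex : Fin N → Fin N) (ind rr : Fin N → ℕ)
  (hrr3 : ∀ x, τ (τ x) ≠ x → 3 ≤ rr x)
  (hind : ∀ x, τ (τ x) ≠ x → ind x < rr x ∧ (τ ^ (ind x)) (apex x) = x)
  (hper : ∀ x, τ (τ x) ≠ x → ∀ m n : ℕ, (τ ^ m) (apex x) = (τ ^ n) (apex x) ↔ m % rr x = n % rr x)
  (hpow : ∀ x, τ (τ x) ≠ x → ∀ i : ℕ, apex ((τ ^ i) (apex x)) = apex x ∧
    rr ((τ ^ i) (apex x)) = rr x ∧ τ (τ ((τ ^ i) (apex x))) ≠ (τ ^ i) (apex x) ∧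
    ind ((τ ^ i) (apex x)) = i % rr x)
  (ff : Fin N → ℕ)
  (hff : ∀ x, ff x = if ind x = 0 then rr x - 3 else if 2 ≤ ind x ∧ ind x ≤ rr x - 2 then 1 else 0)

include hper in
/-- **An orbit has at most `N` corners:** `rr x ≤ N` for big `x`. (Arguments: `τ apex rr hper hx`.)
[folklore] -/
theorem fan_orbit_size_le {x : Fin N} (hx : τ (τ x) ≠ x) : rr x ≤ N := by
  have hinj : Set.InjOn (fun i => (τ ^ i) (apex x)) (Finset.range (rr x) : Set ℕ) := by
    intro i hi j hj hij
    rw [Finset.coe_range, Set.mem_Iio] at hi hj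
    have := (hper x hx i j).mp hij
    rwa [Nat.mod_eq_of_lt hi, Nat.mod_eq_of_lt hj] at this
  have h := Finset.card_le_card_of_injOn (fun i => (τ ^ i) (apex x)) (fun i _ => Finset.mem_univ _) hinj
  rwa [Finset.card_range, Finset.card_univ, Fintype.card_fin] at h

include hrr3 hind hper hpow hff in
/-- **Counting the valid pairs:** `#{(x, s) : x big, s ≤ ff x} + 6·#{apexes of big orbits} =
3·#{big corners}`. (Arguments: `τ apex ind rr hrr3 hind hper hpow ff hff`.)
[cite: CalegariWalker2013, §4.4] -/
theorem fan_card_validPairs_add :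
    ((Finset.univ : Finset (Fin N × Fin N)).filter
        (fun p => τ (τ p.1) ≠ p.1 ∧ (p.2 : ℕ) ≤ ff p.1)).card +
      6 * (((Finset.univ : Finset (Fin N)).filter fun x => τ (τ x) ≠ x).image apex).card =
      3 * ((Finset.univ : Finset (Fin N)).filter fun x => τ (τ x) ≠ x).card := by
  set BIG := (Finset.univ : Finset (Fin N)).filter fun x => τ (τ x) ≠ x with hBIG
  set VP := (Finset.univ : Finset (Fin N × Fin N)).filter
    (fun p => τ (τ p.1) ≠ p.1 ∧ (p.2 : ℕ) ≤ ff p.1) with hVP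
  set APEX := BIG.image apex with hAPEX
  have hmemBIG : ∀ x, x ∈ BIG ↔ τ (τ x) ≠ x := fun x => by simp [hBIG]
  -- corner API
  have hqc : ∀ x, τ (τ x) ≠ x → ∀ i, τ (τ ((τ ^ i) (apex x))) ≠ (τ ^ i) (apex x) ∧
      apex ((τ ^ i) (apex x)) = apex x ∧ rr ((τ ^ i) (apex x)) = rr x ∧
      ind ((τ ^ i) (apex x)) = i % rr x := by
    intro x hx i
    obtain ⟨h1, h2, h3, h4⟩ := hpow x hx i
    exact ⟨h3, h1, h2, h4⟩
  have hffle : ∀ x, τ (τ x) ≠ x → ff x + 3 ≤ rr x := by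
    intro x hx
    have := hrr3 x hx
    have := (hind x hx).1
    rw [hff]; split_ifs <;> omega
  have hrrN : ∀ x, τ (τ x) ≠ x → rr x ≤ N := fun x hx => fan_orbit_size_le τ apex rr hper hx
  -- (i) `#VP = ∑_{x ∈ BIG} (ff x + 1)`
  have hmaps1 : ∀ p ∈ VP, p.1 ∈ BIG := by
    intro p hp; rw [hVP, Finset.mem_filter] at hp; rw [hmemBIG]; exact hp.2.1
  have hcardVP : VP.card = ∑ x ∈ BIG, (ff x + 1) := by
    rw [Finset.card_eq_sum_card_fiberwise hmaps1]
    refine Finset.sum_congr rfl fun x hx => ?_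
    rw [hmemBIG] at hx
    have hlt : ff x + 1 ≤ N := by have := hffle x hx; have := hrrN x hx; omega
    rw [← card_univ_filter_val_lt hlt]
    apply Finset.card_bij (fun p _ => p.2)
    · intro p hp
      rw [Finset.mem_filter] at hp ⊢
      rw [hVP, Finset.mem_filter] at hp
      refine ⟨Finset.mem_univ _, ?_⟩
      have := hp.1.2.2; rw [hp.2] at this; omega
    · intro p hp q hq h
      rw [Finset.mem_filter] at hp hq
      exact Prod.ext (hp.2.trans hq.2.symm) h
    · intro s hs
      rw [Finset.mem_filter] at hs
      refine ⟨(x, s), ?_, rfl⟩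
      rw [Finset.mem_filter, hVP, Finset.mem_filter]
      exact ⟨⟨Finset.mem_univ _, hx, show (s : ℕ) ≤ ff x by omega⟩, rfl⟩
  -- (ii) fibres of `apex` on `BIG`
  have hapexBIG : ∀ x ∈ BIG, apex x ∈ APEX := fun x hx => Finset.mem_image_of_mem _ hx
  have hfibre : ∀ a ∈ APEX, ∃ x₀, τ (τ x₀) ≠ x₀ ∧ apex x₀ = a ∧
      (BIG.filter fun x => apex x = a) = (Finset.range (rr x₀)).image fun i => (τ ^ i) (apex x₀) := by
    intro a ha
    rw [hAPEX, Finset.mem_image] at ha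
    obtain ⟨x₀, hx₀, rfl⟩ := ha
    rw [hmemBIG] at hx₀
    refine ⟨x₀, hx₀, rfl, ?_⟩
    ext x
    rw [Finset.mem_filter, hmemBIG, Finset.mem_image]
    constructor
    · rintro ⟨hx, hax⟩
      refine ⟨ind x, Finset.mem_range.mpr ?_, ?_⟩
      · -- `rr x = rr x₀`
        have h1 := (hind x hx).2
        rw [hax] at h1
        have := (hqc x₀ hx₀ (ind x)).2.2.1
        rw [h1] at this
        rw [← this]; exact (hind x hx).1
      · have h1 := (hind x hx).2
        rw [hax] at h1; exact h1
    · rintro ⟨i, _, rfl⟩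
      exact ⟨(hqc x₀ hx₀ i).1, (hqc x₀ hx₀ i).2.1⟩
  have hinj : ∀ x₀, τ (τ x₀) ≠ x₀ →
      Set.InjOn (fun i => (τ ^ i) (apex x₀)) (Finset.range (rr x₀) : Set ℕ) := by
    intro x₀ hx₀ i hi j hj hij
    rw [Finset.coe_range, Set.mem_Iio] at hi hj
    have := (hper x₀ hx₀ i j).mp hij
    rwa [Nat.mod_eq_of_lt hi, Nat.mod_eq_of_lt hj] at this
  -- the sum of `ff + 1` over one orbit is `3 r - 6`
  have horbit : ∀ a ∈ APEX, ∑ x ∈ BIG.filter (fun x => apex x = a), (ff x + 1) + 6 =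
      3 * (BIG.filter fun x => apex x = a).card := by
    intro a ha
    obtain ⟨x₀, hx₀, rfl, hF⟩ := hfibre a ha
    rw [hF, Finset.sum_image (hinj x₀ hx₀), Finset.card_image_of_injOn (hinj x₀ hx₀),
      Finset.card_range]
    have hr := hrr3 x₀ hx₀
    -- evaluate `ff` along the orbit
    have hffi : ∀ i ∈ Finset.range (rr x₀), ff ((τ ^ i) (apex x₀)) + 1 =
        (if i = 0 then rr x₀ - 3 else if 2 ≤ i ∧ i ≤ rr x₀ - 2 then 1 else 0) + 1 := by
      intro i hi
      rw [Finset.mem_range] at hi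
      rw [hff, (hqc x₀ hx₀ i).2.2.2, (hqc x₀ hx₀ i).2.2.1, Nat.mod_eq_of_lt hi]
    rw [Finset.sum_congr rfl hffi, Finset.sum_add_distrib, Finset.sum_const, Finset.card_range,
      smul_eq_mul, mul_one]
    -- `∑_{i<r} f i = 2r - 6`
    have hsum : ∑ i ∈ Finset.range (rr x₀),
        (if i = 0 then rr x₀ - 3 else if 2 ≤ i ∧ i ≤ rr x₀ - 2 then 1 else 0) = 2 * rr x₀ - 6 := by
      rw [show rr x₀ = (rr x₀ - 1) + 1 by omega, Finset.sum_range_succ']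
      simp only [Nat.succ_ne_zero, if_false, if_true]
      rw [show rr x₀ - 1 + 1 = rr x₀ by omega]
      rw [Finset.sum_boole]
      have hc : ((Finset.range (rr x₀ - 1)).filter fun i => 2 ≤ i + 1 ∧ i + 1 ≤ rr x₀ - 2).card =
          rr x₀ - 3 := by
        have : ((Finset.range (rr x₀ - 1)).filter fun i => 2 ≤ i + 1 ∧ i + 1 ≤ rr x₀ - 2) =
            Finset.Ico 1 (rr x₀ - 2) := by
          ext i; simp only [Finset.mem_filter, Finset.mem_range, Finset.mem_Ico]; omega
        rw [this, Nat.card_Ico]; omega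
      simp only [Nat.cast_id]
      rw [hc]; omega
    rw [hsum]; omega
  -- (iii) assemble
  rw [hcardVP, ← Finset.sum_fiberwise_of_maps_to hapexBIG]
  have hcardBIG : BIG.card = ∑ a ∈ APEX, (BIG.filter fun x => apex x = a).card :=
    Finset.card_eq_sum_card_fiberwise hapexBIG
  rw [hcardBIG, Finset.mul_sum, Finset.card_eq_sum_ones APEX, Finset.mul_sum, ← Finset.sum_add_distrib]
  refine Finset.sum_congr rfl fun a ha => ?_
  rw [mul_one]
  exact horbit a ha

include hrr3 hind hper hpow hff in
/-- **`#tokens + 6·orb(τ) ≤ 3N`.** For a fixed-point-free `τ`: the valid pairs of the fan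
resolution plus six times the number of orbits of `τ` is at most `3N` (with equality, in fact:
a big orbit of size `r` carries `3r − 6` valid pairs, a bivalent orbit has `2` points and no
pairs). (Arguments: `τ apex ind rr hrr3 hind hper hpow ff hff hτ`.) [cite: CalegariWalker2013, §4.4
with Lemma 4.10 (`χ = O(n / log n)`)] -/
theorem fan_card_validPairs_add_six_mul_orbitCount_le (hτ : ∀ x, τ x ≠ x) :
    ((Finset.univ : Finset (Fin N × Fin N)).filter
        (fun p => τ (τ p.1) ≠ p.1 ∧ (p.2 : ℕ) ≤ ff p.1)).card + 6 * orbitCount τ ≤ 3 * N := by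
  have hmain := fan_card_validPairs_add τ apex ind rr hrr3 hind hper hpow ff hff
  set BIG := (Finset.univ : Finset (Fin N)).filter fun x => τ (τ x) ≠ x with hBIG
  set BIV := (Finset.univ : Finset (Fin N)).filter fun x => ¬ τ (τ x) ≠ x with hBIV
  set VP := (Finset.univ : Finset (Fin N × Fin N)).filter
    (fun p => τ (τ p.1) ≠ p.1 ∧ (p.2 : ℕ) ≤ ff p.1) with hVP
  set APEX := BIG.image apex with hAPEX
  -- orbits = values of `cycleOf`
  set cy : Fin N → Equiv.Perm (Fin N) := fun x => τ.cycleOf x with hcy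
  have horb : orbitCount τ = (Finset.univ.image cy).card := by
    rw [← card_image_cycleLabel τ]
    have hlab : (fun x : Fin N => (τ.cycleOf x, if τ x = x then some x else none)) =
        (fun c : Equiv.Perm (Fin N) => (c, (none : Option (Fin N)))) ∘ cy := by
      funext x
      simp [hcy, if_neg (hτ x)]
    rw [hlab, ← Finset.image_image, Finset.card_image_of_injective _ (fun c c' h =>
      (Prod.ext_iff.mp h).1)]
  -- split the corners
  have huniv : (Finset.univ : Finset (Fin N)) = BIG ∪ BIV := by
    rw [hBIG, hBIV, Finset.filter_union_filter_not_eq]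
  have hN : BIG.card + BIV.card = N := by
    have h := Finset.card_filter_add_card_filter_not
      (s := (Finset.univ : Finset (Fin N))) (fun x => τ (τ x) ≠ x)
    rw [Finset.card_univ, Fintype.card_fin] at h
    exact h
  have himg : (Finset.univ.image cy).card ≤ (BIG.image cy).card + (BIV.image cy).card := by
    rw [huniv, Finset.image_union]; exact Finset.card_union_le _ _
  -- big orbits are labelled by apexes
  have hbigimg : (BIG.image cy).card ≤ APEX.card := by
    have hsub : BIG.image cy ⊆ APEX.image cy := by
      intro c hc
      rw [Finset.mem_image] at hc ⊢
      obtain ⟨x, hx, rfl⟩ := hc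
      have hx' : τ (τ x) ≠ x := by rw [hBIG, Finset.mem_filter] at hx; exact hx.2
      refine ⟨apex x, Finset.mem_image_of_mem _ hx, ?_⟩
      have hsc : τ.SameCycle (apex x) x := ⟨(ind x : ℤ), by rw [zpow_natCast]; exact (hind x hx').2⟩
      simp only [hcy]
      exact hsc.cycleOf_eq
    exact (Finset.card_le_card hsub).trans Finset.card_image_le
  -- bivalent orbits have two points
  have hbivimg : 2 * (BIV.image cy).card ≤ BIV.card := by
    have hmaps : ∀ x ∈ BIV, cy x ∈ BIV.image cy := fun x hx => Finset.mem_image_of_mem _ hx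
    rw [Finset.card_eq_sum_card_fiberwise hmaps, Finset.card_eq_sum_ones (BIV.image cy),
      Finset.mul_sum]
    refine Finset.sum_le_sum fun c hc => ?_
    rw [mul_one]
    rw [Finset.mem_image] at hc
    obtain ⟨x, hx, rfl⟩ := hc
    have hxb : τ (τ x) = x := by rw [hBIV, Finset.mem_filter] at hx; push Not at hx; exact hx.2
    have hτx : τ x ∈ BIV := by
      rw [hBIV, Finset.mem_filter]; refine ⟨Finset.mem_univ _, ?_⟩; push Not; rw [hxb]
    refine Finset.one_lt_card.mpr ⟨x, ?_, τ x, ?_, (hτ x).symm⟩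
    · rw [Finset.mem_filter]; exact ⟨hx, rfl⟩
    · rw [Finset.mem_filter]; refine ⟨hτx, ?_⟩
      simp only [hcy]; exact Equiv.Perm.cycleOf_self_apply τ x
  rw [horb]
  omega

include hrr3 hind hper hff in
/-- **Pairs over a set of big corners.** For `P ⊆ big`: `#{(x, s) : P x, s ≤ ff x} =
∑_{x : P x} (ff x + 1)`. (Arguments: `τ apex ind rr hrr3 hind hper ff hff P hP`.) [folklore] -/
theorem fan_card_pairs_eq_sum (P : Fin N → Prop) [DecidablePred P] (hP : ∀ x, P x → τ (τ x) ≠ x) :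
    ((Finset.univ : Finset (Fin N × Fin N)).filter (fun p => P p.1 ∧ (p.2 : ℕ) ≤ ff p.1)).card =
      ∑ x ∈ (Finset.univ : Finset (Fin N)).filter P, (ff x + 1) := by
  have hffle : ∀ x, τ (τ x) ≠ x → ff x + 3 ≤ rr x := by
    intro x hx
    have := hrr3 x hx
    have := (hind x hx).1
    rw [hff]; split_ifs <;> omega
  have hmaps : ∀ p ∈ (Finset.univ : Finset (Fin N × Fin N)).filter (fun p => P p.1 ∧ (p.2 : ℕ) ≤ ff p.1),
      p.1 ∈ (Finset.univ : Finset (Fin N)).filter P := by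
    intro p hp; rw [Finset.mem_filter] at hp ⊢; exact ⟨Finset.mem_univ _, hp.2.1⟩
  rw [Finset.card_eq_sum_card_fiberwise hmaps]
  refine Finset.sum_congr rfl fun x hx => ?_
  rw [Finset.mem_filter] at hx
  have hxb := hP x hx.2
  have hlt : ff x + 1 ≤ N := by
    have := hffle x hxb; have := fan_orbit_size_le τ apex rr hper hxb; omega
  rw [← card_univ_filter_val_lt hlt]
  apply Finset.card_bij (fun p _ => p.2)
  · intro p hp
    rw [Finset.mem_filter, Finset.mem_filter] at hp
    rw [Finset.mem_filter]
    refine ⟨Finset.mem_univ _, ?_⟩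
    have := hp.1.2.2; rw [hp.2] at this; omega
  · intro p hp q hq h
    rw [Finset.mem_filter] at hp hq
    exact Prod.ext (hp.2.trans hq.2.symm) h
  · intro s hs
    rw [Finset.mem_filter] at hs
    refine ⟨(x, s), ?_, rfl⟩
    rw [Finset.mem_filter, Finset.mem_filter]
    exact ⟨⟨Finset.mem_univ _, hx.2, show (s : ℕ) ≤ ff x by omega⟩, rfl⟩

include hrr3 hind hper hpow hff in
/-- **Valid pairs at bad corners are few.** If the apex of a big orbit is bad only when the whole
orbit is bad, then `#{(x, s) valid : x ∈ Bad} ≤ 3·#Bad` (a non-apex corner carries `≤ 2` pairs; a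
bad apex carries `r − 2 ≤ r = #orbit ≤ #(Bad ∩ orbit)` pairs).
(Arguments: `τ apex ind rr hrr3 hind hper hpow ff hff Bad hbad`.) [cite: CalegariWalker2013, §4.4] -/
theorem fan_card_validPairs_bad_le (Bad : Finset (Fin N))
    (hbad : ∀ x, τ (τ x) ≠ x → apex x ∈ Bad → ∀ i : ℕ, (τ ^ i) (apex x) ∈ Bad) :
    ((Finset.univ : Finset (Fin N × Fin N)).filter
        (fun p => (τ (τ p.1) ≠ p.1 ∧ p.1 ∈ Bad) ∧ (p.2 : ℕ) ≤ ff p.1)).card ≤ 3 * Bad.card := by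
  rw [fan_card_pairs_eq_sum τ apex ind rr hrr3 hind hper ff hff (fun x => τ (τ x) ≠ x ∧ x ∈ Bad)
    (fun x h => h.1)]
  set S := (Finset.univ : Finset (Fin N)).filter (fun x => τ (τ x) ≠ x ∧ x ∈ Bad) with hS
  have hmemS : ∀ x, x ∈ S ↔ τ (τ x) ≠ x ∧ x ∈ Bad := fun x => by simp [hS]
  rw [← Finset.sum_filter_add_sum_filter_not S (fun x => ind x = 0)]
  -- non-apex corners: `ff x + 1 ≤ 2`
  have h1 : ∑ x ∈ S.filter (fun x => ¬ ind x = 0), (ff x + 1) ≤ 2 * Bad.card := by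
    calc ∑ x ∈ S.filter (fun x => ¬ ind x = 0), (ff x + 1)
        ≤ ∑ _x ∈ S.filter (fun x => ¬ ind x = 0), 2 := by
          refine Finset.sum_le_sum fun x hx => ?_
          rw [Finset.mem_filter] at hx
          rw [hff, if_neg hx.2]; split_ifs <;> omega
      _ = 2 * (S.filter (fun x => ¬ ind x = 0)).card := by rw [Finset.sum_const, smul_eq_mul, mul_comm]
      _ ≤ 2 * Bad.card := by
          refine Nat.mul_le_mul_left 2 (Finset.card_le_card ?_)
          intro x hx; rw [Finset.mem_filter, hmemS] at hx; exact hx.1.2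
  -- apexes: the whole orbit is bad, orbits are disjoint
  have h0 : ∑ x ∈ S.filter (fun x => ind x = 0), (ff x + 1) ≤ Bad.card := by
    set S0 := S.filter (fun x => ind x = 0) with hS0
    set F : Fin N → Finset (Fin N) := fun x => (Finset.range (rr x)).image fun i => (τ ^ i) (apex x)
      with hF
    have hmem0 : ∀ x ∈ S0, τ (τ x) ≠ x ∧ x ∈ Bad ∧ apex x = x := by
      intro x hx
      rw [hS0, Finset.mem_filter, hmemS] at hx
      refine ⟨hx.1.1, hx.1.2, ?_⟩
      have h := (hind x hx.1.1).2
      rw [hx.2, pow_zero, Equiv.Perm.one_apply] at h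
      exact h
    have hinj : ∀ x, τ (τ x) ≠ x →
        Set.InjOn (fun i => (τ ^ i) (apex x)) (Finset.range (rr x) : Set ℕ) := by
      intro x hx i hi j hj hij
      rw [Finset.coe_range, Set.mem_Iio] at hi hj
      have := (hper x hx i j).mp hij
      rwa [Nat.mod_eq_of_lt hi, Nat.mod_eq_of_lt hj] at this
    have hcardF : ∀ x ∈ S0, (F x).card = rr x := by
      intro x hx
      rw [hF, Finset.card_image_of_injOn (hinj x (hmem0 x hx).1), Finset.card_range]
    have hle : ∀ x ∈ S0, ff x + 1 ≤ (F x).card := by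
      intro x hx
      rw [hcardF x hx, hff, if_pos (by rw [hS0, Finset.mem_filter] at hx; exact hx.2)]
      have := hrr3 x (hmem0 x hx).1
      omega
    have hdisj : ∀ x ∈ S0, ∀ y ∈ S0, x ≠ y → Disjoint (F x) (F y) := by
      intro x hx y hy hxy
      rw [Finset.disjoint_left]
      intro z hzx hzy
      rw [hF, Finset.mem_image] at hzx hzy
      obtain ⟨i, _, rfl⟩ := hzx
      obtain ⟨j, _, hj⟩ := hzy
      have h1 := (hpow x (hmem0 x hx).1 i).1
      have h2 := (hpow y (hmem0 y hy).1 j).1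
      rw [hj] at h2
      -- `apex z = apex x = x` and `apex z = apex y = y`
      have e := h1.symm.trans h2
      rw [(hmem0 x hx).2.2, (hmem0 y hy).2.2] at e
      exact hxy e
    have hsubBad : S0.biUnion F ⊆ Bad := by
      intro z hz
      rw [Finset.mem_biUnion] at hz
      obtain ⟨x, hx, hzx⟩ := hz
      rw [hF, Finset.mem_image] at hzx
      obtain ⟨i, _, rfl⟩ := hzx
      exact hbad x (hmem0 x hx).1 (by rw [(hmem0 x hx).2.2]; exact (hmem0 x hx).2.1) i
    calc ∑ x ∈ S0, (ff x + 1) ≤ ∑ x ∈ S0, (F x).card := Finset.sum_le_sum hle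
      _ = (S0.biUnion F).card := (Finset.card_biUnion hdisj).symm
      _ ≤ Bad.card := Finset.card_le_card hsubBad
  omega

include hrr3 hind hper hff in
/-- **Sums over real tokens are sums over big corners.** For any `Q`,
`∑_{(x, s) valid} (if s = ff x then Q x else 0) = ∑_{x big} Q x`.
(Arguments: `τ apex ind rr hrr3 hind hper ff hff Q`.) [folklore] -/
theorem fan_sum_real_eq {M : Type*} [AddCommMonoid M] (Q : Fin N → M) :
    ∑ p ∈ (Finset.univ : Finset (Fin N × Fin N)).filter
        (fun p => τ (τ p.1) ≠ p.1 ∧ (p.2 : ℕ) ≤ ff p.1),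
      (if (p.2 : ℕ) = ff p.1 then Q p.1 else 0) =
      ∑ x ∈ (Finset.univ : Finset (Fin N)).filter (fun x => τ (τ x) ≠ x), Q x := by
  have hffle : ∀ x, τ (τ x) ≠ x → ff x + 3 ≤ rr x := by
    intro x hx
    have := hrr3 x hx
    have := (hind x hx).1
    rw [hff]; split_ifs <;> omega
  have hmaps : ∀ p ∈ (Finset.univ : Finset (Fin N × Fin N)).filter
      (fun p => τ (τ p.1) ≠ p.1 ∧ (p.2 : ℕ) ≤ ff p.1),
      p.1 ∈ (Finset.univ : Finset (Fin N)).filter (fun x => τ (τ x) ≠ x) := by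
    intro p hp; rw [Finset.mem_filter] at hp ⊢; exact ⟨Finset.mem_univ _, hp.2.1⟩
  rw [← Finset.sum_fiberwise_of_maps_to hmaps]
  refine Finset.sum_congr rfl fun x hx => ?_
  rw [Finset.mem_filter] at hx
  have hlt : ff x < N := by
    have := hffle x hx.2; have := fan_orbit_size_le τ apex rr hper hx.2; omega
  rw [Finset.sum_ite, Finset.sum_const_zero, add_zero]
  have hsing : (((Finset.univ : Finset (Fin N × Fin N)).filter
      (fun p => τ (τ p.1) ≠ p.1 ∧ (p.2 : ℕ) ≤ ff p.1)).filter (fun p => p.1 = x)).filter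
      (fun p => (p.2 : ℕ) = ff p.1) = {(x, ⟨ff x, hlt⟩)} := by
    ext p
    simp only [Finset.mem_filter, Finset.mem_univ, true_and, Finset.mem_singleton]
    constructor
    · rintro ⟨⟨_, h1⟩, h2⟩
      ext
      · exact congrArg Fin.val h1
      · simp; rw [h2, h1]
    · rintro rfl
      exact ⟨⟨⟨hx.2, le_rfl⟩, rfl⟩, rfl⟩
  rw [hsing, Finset.sum_singleton]

end FanCounts

end Literature.GroupTheory.CombinatorialGroupTheory

end
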